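import Literature.Analysis.FluidPDE.PineauVicolCylinderRegularity
import HarnessLib

/-!
# Route CorkscrewDynamo · crux `CorkscrewProfile` (stmt-NavierStokesRegularity-11282) — stub
# `stub_typeIGradientBound`: the scale-invariant gradient bound of a classical Type-I solution on `(−∞, 0)`

Stub `stub_typeIGradientBound` of line `registered` (lead c7): a classical solution `(u, p)` of
Navier–Stokes (`ν = 1`, `f = 0`) on `(−∞, 0)` with the Type-I bound
`|u(x,t)| ≤ C₀/(|x| + √(−t))` has the scale-invariant gradient bound
`‖Du(t)(x)‖ ≤ K / max{‖x‖, √(−t)}²` for all `t < 0`, `x`, with `K = K(C₀) ≥ 0`; the lead uses it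
to bound `|ω|² ≤ (‖curlCLM‖K)²/(−t)²`.

Proof. Pineau–Vicol 2026, Lemma 7.1 in physical variables
(`exists_forall_iteratedFDeriv_le_of_typeI` with `n = 1`) gives
`‖D¹u(t)(x)‖ ≤ K · (max{‖x‖, √(−t)}⁻¹)²`; `‖D¹u‖ = ‖Du‖` (`norm_iteratedFDeriv_one`) and
`K · (m⁻¹)² = K / m²` (`inv_pow`, `div_eq_mul_inv`).
-/

noncomputable section

open MeasureTheory Set Function Filter Topology InnerProductSpace Metric
open Literature.Analysis.FluidPDE Literature.Analysis.FluidPDE.PineauVicol2026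
open scoped RealInnerProductSpace Laplacian ContDiff NNReal ENNReal

namespace Summit.NavierStokesRegularity.NavierStokesRegularity.Theorems.CorkscrewProfile.Birth

set_option linter.dupNamespace false

/-- **Stub `stub_typeIGradientBound` (Pineau–Vicol 2026, Lemma 7.1 with `n = 1`, physical
variables).** For a classical solution `(u, p)` of Navier–Stokes (`ν = 1`, `f = 0`) on `(−∞, 0)`
with the Type-I bound `|u(x,t)| ≤ C₀/(|x| + √(−t))`, the gradient has the scale-invariant decay
`‖Du(t)(x)‖ ≤ K / max{‖x‖, √(−t)}²` for all `t < 0` and `x`, for one `K = K(C₀) ≥ 0`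
(`exists_forall_iteratedFDeriv_le_of_typeI 1 C₀`, `‖iteratedFDeriv 1‖ = ‖fderiv‖`,
`K · (m⁻¹)² = K / m²`). [cite: PineauVicol2026, Lemma 7.1] -/
theorem stub_typeIGradientBound {C₀ : ℝ}
    {u : ℝ → EuclideanSpace ℝ (Fin 3) → EuclideanSpace ℝ (Fin 3)} {p : ℝ → EuclideanSpace ℝ (Fin 3) → ℝ}
    (hsol : IsClassicalNSSolutionOn (Set.Iio 0) 1 0 u p)
    (hI : ∀ t < 0, ∀ x, ‖u t x‖ ≤ C₀ / (‖x‖ + Real.sqrt (-t))) :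
    ∃ K : ℝ, 0 ≤ K ∧ ∀ t < 0, ∀ x : EuclideanSpace ℝ (Fin 3),
      ‖fderiv ℝ (u t) x‖ ≤ K / (max ‖x‖ (Real.sqrt (-t))) ^ 2 := by
  obtain ⟨K, hK0, hK⟩ := exists_forall_iteratedFDeriv_le_of_typeI 1 C₀
  refine ⟨K, hK0, fun t ht x => ?_⟩
  have hI' : ∀ t ∈ Iio (0 : ℝ), ∀ x : EuclideanSpace ℝ (Fin 3),
      ‖u t x‖ ≤ C₀ / (‖x‖ + Real.sqrt (-t)) :=
    fun s hs y => hI s (Set.mem_Iio.1 hs) y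
  have h := hK u p hsol hI' t (Set.mem_Iio.2 ht) x
  rw [norm_iteratedFDeriv_one, inv_pow, ← div_eq_mul_inv] at h
  exact h

end Summit.NavierStokesRegularity.NavierStokesRegularity.Theorems.CorkscrewProfile.Birth
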